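import Summits.QuantumFields.BalabanUV.T4Continuum.E3Cert.ZL2d3AllU.Data
/-! E3 certificate package `ZL2d3AllU` — module `S4` ((3,2,1) block, d = 3, L = 2, all-U, γ = 511∕512; emitter `bal_e3_lean_emit.py` output for
`block-L2d3-su2-allU-dyadic.json`, lane `run/shared/lean/ttrl/balaban-calc/e3/lean-draft/tree/zL2d3AllU/S4.lean`; TREE COPY by the substrate cell (seat p2), typer
ruling (μ3)(e), journal l.19196, following the E3 PILOT's scripted road (`substrate/p3/E3-PILOT.md`): import prefix substituted and one-line
docstrings added BY SCRIPT, no literal touched).  Meaning of the certificate: see `Data.lean` ∕ `Main.lean` of this package and the checker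
`E3Cert/E3PolyCertZ*.lean`.  HONEST: certified computation on ONE small block — NOT Prop. (1.8), NOT an input of any NE row today, NOT infinite
volume ∕ mass gap ∕ Clay. -/
set_option maxRecDepth 200000
set_option maxHeartbeats 0
namespace E3Z
/-- E3 certificate `zL2d3AllU` component: `zL2d3AllU_sl32` (lane output, transcribed verbatim; see the module docstring). -/
theorem zL2d3AllU_sl32 : GramCert.mainSlice zL2d3AllU 32 = true := by
  decide +kernel
/-- E3 certificate `zL2d3AllU` component: `zL2d3AllU_blk0` (lane output, transcribed verbatim; see the module docstring). -/
theorem zL2d3AllU_blk0 : (GramCert.blockCert zL2d3AllU.nx zL2d3AllU.basis (zL2d3AllU.blocks.getD 0 (⟨[], 0, [], 0, []⟩, 0)).1).check = true := by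
  decide +kernel
/-- E3 certificate `zL2d3AllU` component: `zL2d3AllU_blk1` (lane output, transcribed verbatim; see the module docstring). -/
theorem zL2d3AllU_blk1 : (GramCert.blockCert zL2d3AllU.nx zL2d3AllU.basis (zL2d3AllU.blocks.getD 1 (⟨[], 0, [], 0, []⟩, 0)).1).check = true := by
  decide +kernel
/-- E3 certificate `zL2d3AllU` component: `zL2d3AllU_blk2` (lane output, transcribed verbatim; see the module docstring). -/
theorem zL2d3AllU_blk2 : (GramCert.blockCert zL2d3AllU.nx zL2d3AllU.basis (zL2d3AllU.blocks.getD 2 (⟨[], 0, [], 0, []⟩, 0)).1).check = true := by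
  decide +kernel
/-- E3 certificate `zL2d3AllU` component: `zL2d3AllU_blk3` (lane output, transcribed verbatim; see the module docstring). -/
theorem zL2d3AllU_blk3 : (GramCert.blockCert zL2d3AllU.nx zL2d3AllU.basis (zL2d3AllU.blocks.getD 3 (⟨[], 0, [], 0, []⟩, 0)).1).check = true := by
  decide +kernel
/-- E3 certificate `zL2d3AllU` component: `zL2d3AllU_blk4` (lane output, transcribed verbatim; see the module docstring). -/
theorem zL2d3AllU_blk4 : (GramCert.blockCert zL2d3AllU.nx zL2d3AllU.basis (zL2d3AllU.blocks.getD 4 (⟨[], 0, [], 0, []⟩, 0)).1).check = true := by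
  decide +kernel
/-- E3 certificate `zL2d3AllU` component: `zL2d3AllU_blk5` (lane output, transcribed verbatim; see the module docstring). -/
theorem zL2d3AllU_blk5 : (GramCert.blockCert zL2d3AllU.nx zL2d3AllU.basis (zL2d3AllU.blocks.getD 5 (⟨[], 0, [], 0, []⟩, 0)).1).check = true := by
  decide +kernel
/-- E3 certificate `zL2d3AllU` component: `zL2d3AllU_eq0` (lane output, transcribed verbatim; see the module docstring). -/
theorem zL2d3AllU_eq0 : GramCert.eqCheck (zL2d3AllU.eq.getD 0 ([], [], [])) = true := by
  decide +kernel
end E3Z
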